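import Summits.NavierStokesRegularity.NavierStokesRegularity.Theses.RellichScar
import Summits.NavierStokesRegularity.NavierStokesRegularity.Theorems.ScarRigidity.Negative.LogicAndLoadBearing
import Literature.Analysis.FluidPDE.TypeIAncientMild
import Literature.Analysis.FluidPDE.ParasiticSlabFlow
import Summits.NavierStokesRegularity.NavierStokesRegularity.Theorems.RellichScarScarRigidityApexBoundsFar
import Summits.NavierStokesRegularity.NavierStokesRegularity.Theorems.RellichScarScarRigidityApexBoundsElliptic
import Literature.Analysis.FluidPDE.LerayPressureDecayProofs
import Literature.Analysis.FluidPDE.LocalLerayPressureDecompositionProofs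
import Literature.Analysis.FluidPDE.PressurePoisson
import Literature.Analysis.FluidPDE.SpaceTimeCalculusC1
import HarnessLib

/-!
# `ScarRigidity` — line `finite-energy-log-convexity`, stub `stub_apexDerivativeBounds`:
# the pressure gradient at unit scale (crux stmt-NavierStokesRegularity-11717, route RellichScar)

Helper file for S1β. For a Type-I ancient mild apex profile `V` (`IsTypeIAncientMild C V`,
`HasTypeIDecay C V`), a point `(s, x')`, `s < 0`, near which `‖V‖ ≤ 2C` (on
`{τ < s/2} × B_{1/2}(x')`), and ANY classical pressure `p` of `V` on a window `(a₀, 0) ∋ s`, we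
bound the canonical quantity `‖∇p(s, x')‖` by a constant depending on `C` only
(`exists_unit_pressure_gradient_bound`). The window construction of `ApexBoundsFar`
(local Leray solution on `[t₀, T_e)`, Jia–Šverák's a priori estimate, higher regularity on a
fixed cylinder) gives `‖DⁿV‖ ≤ K₀` (`n ≤ 3`) on a parabolic cylinder through `(s, x')`; the
local pressure expansion of the class at radius `1/8` (`exists_pressure_decomposition`,
Kang–Miura–Tsai 2021, Lemma 3.4) with the Calderón–Zygmund slice bound for the near part
(`exists_lintegral_localPressureNear_le`) and the kernel bound for the far part
(`enorm_localPressureFar_le`, fed by the apex bound through `exists_far_tail_bound`) bounds the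
slice oscillation `∫_{B_{1/8}(x')} |p(τ) - c(τ)|` for a.e. `τ`; Green's representation at a
fixed scale (`abs_fderiv_apply_le_newton`) with the pressure Poisson equation
`Δp = -div((V·∇)V)` then bounds `∇p(τ, x')` for a.e. `τ` near `s`, hence at `s` by continuity.
-/

noncomputable section

open Set Filter Function MeasureTheory Metric TopologicalSpace
open scoped Topology ENNReal NNReal InnerProductSpace RealInnerProductSpace
open Literature.Analysis.FluidPDE
open Summit.NavierStokesRegularity.NavierStokesRegularity.Theses.RellichScar
open Summit.NavierStokesRegularity.NavierStokesRegularity.Theorems.ScarRigidity.Negative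

set_option linter.dupNamespace false

namespace Summit.NavierStokesRegularity.NavierStokesRegularity.Theorems.RellichScarScarRigidity

open Literature.Analysis
open scoped Laplacian

/-! ## The far-field tail of the local pressure expansion -/

/-- **Uniform far-field tail**: there is `Tl = Tl(C) < ∞` with
`∫_{|y - x'| ≥ 1/4} |V(t,y)|² |y - x'|⁻⁴ dy ≤ Tl` for all `t < 0`, all centres `x'` and all apex
profiles of constant `C` (the shell `1/4 ≤ |y - x'| < 2` by the ball energy bound at radius `2`,
the exterior by the uniformly local tail `lintegral_compl_ball_mul_powKer_le`). [folklore] -/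
theorem exists_far_tail_bound (C : ℝ) :
    ∃ Tl : ℝ≥0∞, Tl ≠ ⊤ ∧ ∀ ⦃V : ℝ → (EuclideanSpace ℝ (Fin 3)) → (EuclideanSpace ℝ (Fin 3))⦄, IsTypeIAncientMild C V → HasTypeIDecay C V →
      ∀ t < 0, ∀ x' : (EuclideanSpace ℝ (Fin 3)),
        ∫⁻ y in (ball x' (1 / 4))ᶜ, ‖V t y‖ₑ ^ (2 : ℕ) * RieszKernel.powKer 4 (y - x') ≤ Tl := by
  obtain ⟨α₁, hα₁⟩ := exists_ball_energy_bound C one_pos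
  obtain ⟨α₂, hα₂⟩ := exists_ball_energy_bound C (ρ := 2) two_pos
  set P₄ : ℝ≥0∞ := ∫⁻ z in (ball (0 : (EuclideanSpace ℝ (Fin 3))) (2 - 1))ᶜ, RieszKernel.powKer 4 z with hP₄
  have hP₄top : P₄ < ⊤ := RieszKernel.lintegral_compl_ball_powKer_lt_top (by norm_num) (by norm_num)
  set Tl : ℝ≥0∞ := ENNReal.ofReal 256 * (2 * (α₂ : ℝ≥0∞)) +
    (volume (ball (0 : (EuclideanSpace ℝ (Fin 3))) 1))⁻¹ * (2 * (α₁ : ℝ≥0∞) * (16 * P₄)) with hTl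
  have hB1 : volume (ball (0 : (EuclideanSpace ℝ (Fin 3))) 1) ≠ 0 := (measure_ball_pos volume (0 : (EuclideanSpace ℝ (Fin 3))) one_pos).ne'
  have hTltop : Tl ≠ ⊤ := by
    refine ENNReal.add_ne_top.2 ⟨ENNReal.mul_ne_top ENNReal.ofReal_ne_top
      (ENNReal.mul_ne_top (by norm_num) ENNReal.coe_ne_top), ?_⟩
    refine ENNReal.mul_ne_top (ENNReal.inv_ne_top.2 hB1) ?_
    exact ENNReal.mul_ne_top (ENNReal.mul_ne_top (by norm_num) ENNReal.coe_ne_top)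
      (ENNReal.mul_ne_top (by norm_num) hP₄top.ne)
  refine ⟨Tl, hTltop, fun V hV hd t ht x' => ?_⟩
  set g : (EuclideanSpace ℝ (Fin 3)) → ℝ≥0∞ := fun y => ‖V t y‖ₑ ^ (2 : ℕ) with hg
  have hgm : AEMeasurable g volume := (hV.aestronglyMeasurable_slice ht).enorm.pow_const _
  -- split the complement of the small ball
  have hsplit : (ball x' (1 / 4))ᶜ ⊆ ((ball x' (1 / 4))ᶜ ∩ ball x' 2) ∪ (ball x' 2)ᶜ := by
    intro y hy
    by_cases h2 : y ∈ ball x' 2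
    · exact Or.inl ⟨hy, h2⟩
    · exact Or.inr h2
  refine (lintegral_mono_set hsplit).trans ((lintegral_union_le _ _ _).trans ?_)
  rw [hTl]
  refine add_le_add ?_ ?_
  · -- the shell: `|y - x'|⁻⁴ ≤ 256`
    calc ∫⁻ y in (ball x' (1 / 4))ᶜ ∩ ball x' 2, g y * RieszKernel.powKer 4 (y - x')
        ≤ ∫⁻ y in (ball x' (1 / 4))ᶜ ∩ ball x' 2, g y * ENNReal.ofReal 256 := by
          refine setLIntegral_mono' (measurableSet_ball.compl.inter measurableSet_ball) fun y hy => ?_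
          gcongr
          rw [RieszKernel.powKer_apply]
          refine ENNReal.ofReal_le_ofReal ?_
          have hy1 : 1 / 4 ≤ ‖y - x'‖ := by
            have := hy.1
            rw [mem_compl_iff, mem_ball, dist_eq_norm, not_lt] at this
            exact this
          calc ‖y - x'‖ ^ (-(4 : ℝ)) ≤ (1 / 4 : ℝ) ^ (-(4 : ℝ)) :=
              Real.rpow_le_rpow_of_nonpos (by norm_num) hy1 (by norm_num)
            _ = 256 := by
                rw [Real.rpow_neg (by norm_num), show (4 : ℝ) = (4 : ℕ) by norm_num, Real.rpow_natCast]
                norm_num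
      _ ≤ ∫⁻ y in ball x' 2, g y * ENNReal.ofReal 256 := lintegral_mono_set inter_subset_right
      _ = ENNReal.ofReal 256 * ∫⁻ y in ball x' 2, g y := by
          rw [lintegral_mul_const' _ _ ENNReal.ofReal_ne_top, mul_comm]
      _ ≤ ENNReal.ofReal 256 * (2 * (α₂ : ℝ≥0∞)) := by gcongr; exact hα₂ hd t ht x'
  · -- the exterior: the uniformly local tail
    have h := lintegral_compl_ball_mul_powKer_le hgm (fun z => hα₁ hd t ht z) x' (le_refl (2 : ℝ))
    exact h

/-! ## The pressure gradient at unit scale -/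

/-- `‖V(τ, y)‖ ≤ M` near `x'` forces `∫_{B_{1/4}(x')} |V(τ)|³ ≤ M³ |B_{1/4}|`. [folklore] -/
theorem lintegral_cube_ball_le {V : ℝ → (EuclideanSpace ℝ (Fin 3)) → (EuclideanSpace ℝ (Fin 3))} {τ : ℝ} {x' : (EuclideanSpace ℝ (Fin 3))} {M : ℝ}
    (h : ∀ y : (EuclideanSpace ℝ (Fin 3)), dist y x' < 1 / 2 → ‖V τ y‖ ≤ M) :
    ∫⁻ y in ball x' (2 * (1 / 8)), ‖V τ y‖ₑ ^ (3 : ℕ) ≤ ENNReal.ofReal M ^ (3 : ℕ) * volume (ball x' (1 / 4)) := by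
  rw [show (2 * (1 / 8) : ℝ) = 1 / 4 by norm_num]
  calc ∫⁻ y in ball x' (1 / 4), ‖V τ y‖ₑ ^ (3 : ℕ) ≤ ∫⁻ _ in ball x' (1 / 4), ENNReal.ofReal M ^ (3 : ℕ) := by
        refine setLIntegral_mono measurable_const fun y hy => ?_
        have h1 : ‖V τ y‖ₑ ≤ ENNReal.ofReal M := by
          rw [← ofReal_norm]
          exact ENNReal.ofReal_le_ofReal (h y ((mem_ball.1 hy).trans (by norm_num)))
        gcongr
    _ = ENNReal.ofReal M ^ (3 : ℕ) * volume (ball x' (1 / 4)) := by rw [setLIntegral_const]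

/-- `a ≤ 1 + a^{3/2}` in `ℝ≥0∞`. [folklore] -/
theorem ennreal_le_one_add_rpow_threeHalves (a : ℝ≥0∞) : a ≤ 1 + a ^ (3 / 2 : ℝ) := by
  rcases le_or_gt a 1 with h | h
  · exact h.trans le_self_add
  · calc a = a ^ (1 : ℝ) := (ENNReal.rpow_one a).symm
      _ ≤ a ^ (3 / 2 : ℝ) := ENNReal.rpow_le_rpow_of_exponent_le h.le (by norm_num)
      _ ≤ 1 + a ^ (3 / 2 : ℝ) := le_add_self

/-- **The pressure gradient at unit scale, uniformly over the class.** There is `K = K(C)` such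
that for every apex profile `V` of constant `C`, every `s < 0` and `x'` with `‖V‖ ≤ 2 max(C,0)` on
`{τ < s/2} × B_{1/2}(x')`, and every classical pressure `p` of `V` on a window `(a₀, 0) ∋ s`:
`‖∇p(s, x')‖ ≤ K` (module docstring). [cite: KangMiuraTsai2020, Lemma 3.4 (pressure decomposition), arXiv:1812.10509 p. 8] [cite: GilbargTrudinger2001, (2.17) and Thm 2.10] -/
theorem exists_unit_pressure_gradient_bound (C : ℝ) :
    ∃ K : ℝ, ∀ ⦃V : ℝ → (EuclideanSpace ℝ (Fin 3)) → (EuclideanSpace ℝ (Fin 3))⦄, IsTypeIAncientMild C V → HasTypeIDecay C V →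
      ∀ s < 0, ∀ x' : (EuclideanSpace ℝ (Fin 3)),
        (∀ τ < s / 2, ∀ y : (EuclideanSpace ℝ (Fin 3)), dist y x' < 1 / 2 → ‖V τ y‖ ≤ 2 * max C 0) →
        ∀ (a₀ : ℝ) (p : ℝ → (EuclideanSpace ℝ (Fin 3)) → ℝ), a₀ < s → IsClassicalNSSolutionOn (Ioo a₀ 0) 1 0 V p →
          ‖gradient (p s) x'‖ ≤ K := by
  obtain ⟨Tw, R, K₀, hTw0, hTw1, hR0, hR12, hR2, hK₀0, hreg⟩ := exists_window_regularity C
  -- ## constants of the pressure estimate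
  obtain ⟨T₀, hT₀0, hT₀⟩ := exists_divergence_convect_bound
  have hr₁ : 0 < R / 12 := by positivity
  obtain ⟨Ae, Be, hAe0, hBe0, hEll⟩ := abs_fderiv_apply_le_newton hr₁
  obtain ⟨CN, hCN0, hCNtop, hCN⟩ :=
    exists_lintegral_localPressureNear_le stein1970_normalisedPressure_ae_Lp_bound_holds
  obtain ⟨CK, hCK0, hCK⟩ := exists_abs_pressureKernel_sub_le
  obtain ⟨Tl, hTltop, hTl⟩ := exists_far_tail_bound C
  set Mv : ℝ := 2 * max C 0 with hMv
  have hMv0 : 0 ≤ Mv := by positivity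
  set G : ℝ := T₀ * (K₀ ^ 2 + K₀ * K₀) with hG
  have hG0 : 0 ≤ G := by positivity
  set vB : ℝ≥0∞ := volume (ball (0 : (EuclideanSpace ℝ (Fin 3))) (1 / 8)) with hvB
  have hvBtop : vB ≠ ⊤ := measure_ball_lt_top.ne
  set Osc : ℝ≥0∞ := vB + CN * (ENNReal.ofReal Mv ^ (3 : ℕ) * volume (ball (0 : (EuclideanSpace ℝ (Fin 3))) (1 / 4))) +
    vB * (ENNReal.ofReal (CK * (1 / 8)) * Tl) with hOsc
  have hOsctop : Osc ≠ ⊤ := by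
    refine ENNReal.add_ne_top.2 ⟨ENNReal.add_ne_top.2 ⟨hvBtop, ?_⟩, ?_⟩
    · exact ENNReal.mul_ne_top hCNtop (ENNReal.mul_ne_top (ENNReal.pow_ne_top ENNReal.ofReal_ne_top)
        measure_ball_lt_top.ne)
    · exact ENNReal.mul_ne_top hvBtop (ENNReal.mul_ne_top ENNReal.ofReal_ne_top hTltop)
  refine ⟨Ae * G + Be * Osc.toReal, fun V hV hd s hs x' hMvV a₀ p' ha₀ hcl' => ?_⟩
  -- ## the window
  obtain ⟨ε, p, hε0, hεs, hεR2, hcl, hLL, hUb⟩ := hreg hV hd s hs x' hMvV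
  set t₀ : ℝ := s - Tw / 2 with ht₀
  set Tsl : ℝ := Tw / 2 + 2 * ε with hTsl
  have hTslt₀ : Tsl + t₀ < 0 := by
    have : Tsl + t₀ = s + 2 * ε := by rw [hTsl, ht₀]; ring
    rw [this]; linarith
  set u : ℝ → (EuclideanSpace ℝ (Fin 3)) → (EuclideanSpace ℝ (Fin 3)) := fun τ => V (τ + t₀) with hu
  set q : ℝ → (EuclideanSpace ℝ (Fin 3)) → ℝ := fun τ => p (τ + t₀) with hq
  have hvcl : IsClassicalNSSolutionOn (Ioo (-1) (-t₀)) 1 0 u q := isClassicalNSSolutionOn_shift hcl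
  have huM : ∀ τ, τ < Tsl → ∀ y : (EuclideanSpace ℝ (Fin 3)), dist y x' < 1 / 2 → ‖u τ y‖ ≤ Mv := by
    intro τ hτ y hy
    have : τ + t₀ < s / 2 := by
      have h1 : Tsl + t₀ ≤ s / 2 := by
        have : Tsl + t₀ = s + 2 * ε := by rw [hTsl, ht₀]; ring
        rw [this]; linarith
      linarith
    exact hMvV (τ + t₀) this y hy
  -- ## the local pressure expansion at radius `1/8`
  obtain ⟨c', -, hdec'⟩ := hLL.exists_pressure_decomposition x' (r := 1 / 8) (by norm_num)
  have hprod : (volume.restrict (Ioo (0 : ℝ) Tsl)).prod (volume.restrict (ball x' (1 / 8))) =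
      volume.restrict (Ioo (0 : ℝ) Tsl ×ˢ ball x' (1 / 8)) := by
    rw [Measure.prod_restrict, ← Measure.volume_eq_prod]
  have hdecτ : ∀ᵐ τ ∂(volume.restrict (Ioo (0 : ℝ) Tsl)), ∀ᵐ x ∂(volume.restrict (ball x' (1 / 8))),
      q τ x = localPressureNear x' (1 / 8) u τ x + localPressureFar x' (1 / 8) u τ x + c' τ := by
    rw [← hprod] at hdec'
    exact Measure.ae_ae_of_ae_prod hdec'
  -- ## the slice oscillation bound for a.e. `τ`
  have hosc : ∀ᵐ τ ∂(volume.restrict (Ioo (0 : ℝ) Tsl)),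
      ∫⁻ x in ball x' (1 / 8), ‖q τ x - c' τ‖ₑ ≤ Osc := by
    filter_upwards [hdecτ, ae_restrict_mem measurableSet_Ioo] with τ hτ hτmem
    have hτ0 : τ + t₀ < 0 := by linarith [hτmem.2]
    -- near part
    have hN : ∫⁻ x in ball x' (1 / 8), ‖localPressureNear x' (1 / 8) u τ x‖ₑ ≤
        vB + CN * (ENNReal.ofReal Mv ^ (3 : ℕ) * volume (ball (0 : (EuclideanSpace ℝ (Fin 3))) (1 / 4))) := by
      have hcube := lintegral_cube_ball_le (huM τ hτmem.2)
      have hfin : ∫⁻ y in ball x' (2 * (1 / 8)), ‖u τ y‖ₑ ^ (3 : ℕ) ≠ ⊤ :=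
        ne_top_of_le_ne_top (ENNReal.mul_ne_top (ENNReal.pow_ne_top ENNReal.ofReal_ne_top)
          measure_ball_lt_top.ne) hcube
      have h32 := hCN x' (1 / 8) u τ (hV.aestronglyMeasurable_slice hτ0) hfin
      calc ∫⁻ x in ball x' (1 / 8), ‖localPressureNear x' (1 / 8) u τ x‖ₑ
          ≤ ∫⁻ x in ball x' (1 / 8), (1 + ‖localPressureNear x' (1 / 8) u τ x‖ₑ ^ (3 / 2 : ℝ)) :=
            lintegral_mono fun x => ennreal_le_one_add_rpow_threeHalves _
        _ = vB + ∫⁻ x in ball x' (1 / 8), ‖localPressureNear x' (1 / 8) u τ x‖ₑ ^ (3 / 2 : ℝ) := by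
            rw [lintegral_add_left measurable_const, setLIntegral_const, one_mul, hvB,
              Measure.addHaar_ball_center]
        _ ≤ vB + ∫⁻ x, ‖localPressureNear x' (1 / 8) u τ x‖ₑ ^ (3 / 2 : ℝ) := by
            gcongr; exact Measure.restrict_le_self
        _ ≤ vB + CN * ∫⁻ y in ball x' (2 * (1 / 8)), ‖u τ y‖ₑ ^ (3 : ℕ) := by gcongr
        _ ≤ vB + CN * (ENNReal.ofReal Mv ^ (3 : ℕ) * volume (ball (0 : (EuclideanSpace ℝ (Fin 3))) (1 / 4))) := by
            gcongr vB + CN * ?_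
            rwa [Measure.addHaar_ball_center] at hcube
    -- far part, pointwise on the small ball
    have hF : ∀ x ∈ ball x' (1 / 8), ‖localPressureFar x' (1 / 8) u τ x‖ₑ ≤
        ENNReal.ofReal (CK * (1 / 8)) * Tl := by
      intro x hx
      refine (enorm_localPressureFar_le hCK0 hCK x' (by norm_num) u τ hx).trans ?_
      gcongr
      have := hTl hV hd (τ + t₀) hτ0 x'
      rwa [show (2 * (1 / 8) : ℝ) = 1 / 4 by norm_num]
    -- assemble
    calc ∫⁻ x in ball x' (1 / 8), ‖q τ x - c' τ‖ₑ
        ≤ ∫⁻ x in ball x' (1 / 8), (‖localPressureNear x' (1 / 8) u τ x‖ₑ +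
            ENNReal.ofReal (CK * (1 / 8)) * Tl) := by
          refine lintegral_mono_ae ?_
          filter_upwards [hτ, ae_restrict_mem measurableSet_ball] with x hx hxB
          rw [hx, show localPressureNear x' (1 / 8) u τ x + localPressureFar x' (1 / 8) u τ x + c' τ - c' τ =
            localPressureNear x' (1 / 8) u τ x + localPressureFar x' (1 / 8) u τ x by ring]
          exact (enorm_add_le _ _).trans (add_le_add le_rfl (hF x hxB))
      _ = (∫⁻ x in ball x' (1 / 8), ‖localPressureNear x' (1 / 8) u τ x‖ₑ) +
            ENNReal.ofReal (CK * (1 / 8)) * Tl * volume (ball x' (1 / 8)) := by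
          rw [lintegral_add_right _ measurable_const, setLIntegral_const]
      _ ≤ Osc := by
          rw [hOsc, Measure.addHaar_ball_center, ← hvB, mul_comm _ vB]
          exact add_le_add hN le_rfl
  -- ## the Laplacian of the pressure slices on the half cylinder
  set Iτ : Set ℝ := Ioo (Tw / 2 + ε - (R / 2) ^ 2) (Tw / 2 + ε) with hIτ
  have hIτ_sub : Iτ ⊆ Ioo 0 Tsl := by
    intro τ hτ
    refine ⟨?_, ?_⟩
    · have : (R / 2) ^ 2 ≤ Tw / 16 := by rw [div_pow]; linarith
      linarith [hτ.1]
    · rw [hTsl]; linarith [hτ.2]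
  have hIτO : Iτ ⊆ Ioo (-1) (-t₀) := by
    intro τ hτ
    have h := hIτ_sub hτ
    exact ⟨by linarith [h.1], by linarith [h.2]⟩
  have hΔ : ∀ τ ∈ Iτ, ∀ w ∈ ball x' (3 * (R / 12)), |(Δ fun x => q τ x - c' τ) w| ≤ G := by
    intro τ hτ w hw
    have hτO : τ ∈ Ioo (-1) (-t₀) := hIτO hτ
    have hq2 : ContDiff ℝ 2 (q τ) := (hvcl.contDiff_pressure hτO).of_le (by norm_cast)
    have hu2 : ContDiff ℝ 2 (u τ) := (hvcl.contDiff_velocity hτO).of_le (by norm_cast)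
    have e1 : (Δ fun x => q τ x - c' τ) w = (Δ (q τ)) w := by
      have hfun : (fun x => q τ x - c' τ) = q τ - fun _ => c' τ := rfl
      rw [hfun, hq2.contDiffAt.laplacian_sub contDiffAt_const]
      simp
    have e2 : (Δ (q τ)) w = -VectorCalculus.divergence (convect (u τ) (u τ)) w := by
      have hint : τ ∈ interior (Ioo (-1 : ℝ) (-t₀)) := by rwa [interior_Ioo]
      have h := laplacian_pressure_eq_of_isClassicalNSSolutionOn hvcl hint w
      rw [h]
      have h0 : VectorCalculus.divergence ((0 : ℝ → (EuclideanSpace ℝ (Fin 3)) → (EuclideanSpace ℝ (Fin 3))) τ) w = 0 := by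
        simp [VectorCalculus.divergence]
      rw [h0, add_zero]
    rw [e1, e2, abs_neg]
    refine (hT₀ (u τ) w hu2).trans ?_
    have hwc : ((τ, w) : ℝ × (EuclideanSpace ℝ (Fin 3))) ∈ parabolicCylinder (R / 2) ((Tw / 2 + ε, x') : ℝ × (EuclideanSpace ℝ (Fin 3))) := by
      rw [mem_parabolicCylinder]
      exact ⟨hτ, (mem_ball.1 hw).trans_le (by linarith)⟩
    have h0 := hUb _ hwc 0 (by norm_num)
    have h1 := hUb _ hwc 1 (by norm_num)
    have h2 := hUb _ hwc 2 (by norm_num)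
    simp only at h0 h1 h2
    rw [norm_iteratedFDeriv_zero] at h0
    rw [norm_iteratedFDeriv_one] at h1
    rw [hG]
    refine mul_le_mul_of_nonneg_left (add_le_add ?_ ?_) hT₀0
    · exact pow_le_pow_left₀ (norm_nonneg _) h1 2
    · exact mul_le_mul h2 h0 (norm_nonneg _) hK₀0
  -- ## the gradient bound for a.e. `τ ∈ Iτ`
  have hgradτ : ∀ a : (EuclideanSpace ℝ (Fin 3)), ∀ᵐ τ ∂(volume.restrict Iτ),
      |fderiv ℝ (q τ) x' a| ≤ ‖a‖ * (Ae * G + Be * Osc.toReal) := by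
    intro a
    have hoscI : ∀ᵐ τ ∂(volume.restrict Iτ), ∫⁻ x in ball x' (1 / 8), ‖q τ x - c' τ‖ₑ ≤ Osc :=
      ae_restrict_of_ae_restrict_of_subset hIτ_sub hosc
    filter_upwards [hoscI, ae_restrict_mem measurableSet_Ioo] with τ hτosc hτ
    have hτO : τ ∈ Ioo (-1) (-t₀) := hIτO hτ
    have hq3 : ContDiff ℝ 3 (fun x => q τ x - c' τ) :=
      ((hvcl.contDiff_pressure hτO).of_le (by norm_cast)).sub contDiff_const
    have h := hEll _ hq3 x' G (hΔ τ hτ) a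
    rw [fderiv_sub_const] at h
    refine h.trans (mul_le_mul_of_nonneg_left (add_le_add le_rfl
      (mul_le_mul_of_nonneg_left ?_ hBe0)) (norm_nonneg _))
    have hsub : closedBall x' (R / 12) ⊆ ball x' (1 / 8) := closedBall_subset_ball (by linarith)
    have hint : IntegrableOn (fun x => q τ x - c' τ) (closedBall x' (R / 12)) :=
      hq3.continuous.continuousOn.integrableOn_compact (isCompact_closedBall _ _)
    have e : (∫ w in closedBall x' (R / 12), |q τ w - c' τ|) =
        (∫⁻ w in closedBall x' (R / 12), ‖q τ w - c' τ‖ₑ).toReal := by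
      rw [← integral_norm_eq_lintegral_enorm hint.aestronglyMeasurable]
      rfl
    rw [e]
    exact ENNReal.toReal_mono hOsctop ((lintegral_mono_set hsub).trans hτosc)
  -- ## continuity in `τ` and the bound at `τ = Tw/2`
  have hTw2 : Tw / 2 ∈ Iτ := ⟨by linarith, by linarith⟩
  have hcontτ : ∀ a : (EuclideanSpace ℝ (Fin 3)), ContinuousOn (fun τ => |fderiv ℝ (q τ) x' a|) Iτ := by
    intro a
    have h1 : ContinuousOn (fun pr : ℝ × (EuclideanSpace ℝ (Fin 3)) => fderiv ℝ (q pr.1) pr.2) (Ioo (-1 : ℝ) (-t₀) ×ˢ univ) :=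
      continuousOn_fderiv_slice_of_contDiffOn (hvcl.smooth_pressure.of_le (by norm_cast))
        isOpen_Ioo.uniqueDiffOn
    have h2 : ContinuousOn (fun τ : ℝ => ((τ, x') : ℝ × (EuclideanSpace ℝ (Fin 3)))) Iτ :=
      (continuous_id.prodMk continuous_const).continuousOn
    have h3 := h1.comp h2 (fun τ hτ => ⟨hIτO hτ, mem_univ _⟩)
    exact (h3.clm_apply continuousOn_const).abs
  have hbound : ∀ a : (EuclideanSpace ℝ (Fin 3)), |fderiv ℝ (q (Tw / 2)) x' a| ≤ ‖a‖ * (Ae * G + Be * Osc.toReal) :=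
    fun a => le_of_ae_le_of_continuousOn isOpen_Ioo (hcontτ a) (hgradτ a) (Tw / 2) hTw2
  have hop : ‖fderiv ℝ (q (Tw / 2)) x'‖ ≤ Ae * G + Be * Osc.toReal := by
    refine ContinuousLinearMap.opNorm_le_bound _ (by positivity) fun a => ?_
    rw [Real.norm_eq_abs, mul_comm]
    exact hbound a
  -- ## transfer to `p'` at `(s, x')`: the gradient is canonical
  have hqs : q (Tw / 2) = p s := by
    funext y
    show p (Tw / 2 + t₀) y = p s y
    congr 1
    rw [ht₀]; ring
  have hsO : s ∈ Ioo (t₀ - 1) 0 := ⟨by linarith, hs⟩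
  have hsO' : s ∈ Ioo a₀ 0 := ⟨ha₀, hs⟩
  have hm1 := hcl.momentum s hsO x'
  have hm2 := hcl'.momentum s hsO' x'
  rw [timeDerivWithin_eq_deriv_of_isOpen_subset isOpen_Ioo subset_rfl hsO] at hm1
  rw [timeDerivWithin_eq_deriv_of_isOpen_subset isOpen_Ioo subset_rfl hsO'] at hm2
  have hgrad : gradient (p' s) x' = gradient (p s) x' := by
    have h3 := hm2.symm.trans hm1
    simpa using h3
  rw [hgrad, gradient, LinearIsometryEquiv.norm_map, ← hqs]
  exact hop

/-! ## Registered sub-goal (helper stub of `stub_apexDerivativeBounds`) -/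

/-- **Registered helper stub `stub_apexUnitPressureGradient`** (sub-goal of
`stub_apexDerivativeBounds`, crux stmt-NavierStokesRegularity-11717): the pressure gradient at unit
scale, uniformly over the class, for every classical window pressure.
[cite: KangMiuraTsai2020, Lemma 3.4 (pressure decomposition), arXiv:1812.10509 p. 8] -/
theorem stub_apexUnitPressureGradient :
    ∀ C : ℝ, ∃ K : ℝ, ∀ (V : ℝ → EuclideanSpace ℝ (Fin 3) → EuclideanSpace ℝ (Fin 3)),
      IsTypeIAncientMild C V → HasTypeIDecay C V → ∀ s < 0, ∀ x' : EuclideanSpace ℝ (Fin 3),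
        (∀ τ < s / 2, ∀ y : EuclideanSpace ℝ (Fin 3), dist y x' < 1 / 2 → ‖V τ y‖ ≤ 2 * max C 0) →
        ∀ (a₀ : ℝ) (p : ℝ → EuclideanSpace ℝ (Fin 3) → ℝ), a₀ < s →
          IsClassicalNSSolutionOn (Ioo a₀ 0) 1 0 V p → ‖gradient (p s) x'‖ ≤ K := by
  intro C
  obtain ⟨K, hK⟩ := exists_unit_pressure_gradient_bound C
  exact ⟨K, fun V hV hd => hK hV hd⟩

end Summit.NavierStokesRegularity.NavierStokesRegularity.Theorems.RellichScarScarRigidity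

end
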